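import Summits.BirchSwinnertonDyer.BirchSwinnertonDyer.Theorems.SelmerRankSelmerRankLBStubDeltaParityNormRelation
import Literature.NumberTheory.EllipticCurves.KatoKolyvaginPrimes
import Literature.NumberTheory.EllipticCurves.CuspFormLFunction
import Literature.NumberTheory.EllipticCurves.PAdicLFunctionFrickeSymmetryProofs
import Literature.NumberTheory.EllipticCurves.PAdicLFunctionDistributionHoldsProofs
import Literature.Barriers.BirchSwinnertonDyer.PAdicFunctionalEquationParityProofs
import Literature.NumberTheory.EllipticCurves.LFunctionPrimeCoeff
import Literature.NumberTheory.EllipticCurves.NonEisensteinPrimeOfSurjective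
import HarnessLib

/-!
# Crux `SelmerRankLB` (stmt-BirchSwinnertonDyer-0131), line `kurihara_order`:
# stub V1 `stub_delta_parity` — the Mazur–Tate functional equation kills the wrong parity

Registered stub V1 of `Cruxes/SelmerRankLB/Lines/kurihara_order.lean` (lead
`prover-line-stmt-BirchSwinnertonDyer-0131-0`), PROVED unconditionally:
for `W/ℚ` globally minimal, `p ≥ 5` with `ρ̄_{E,p}` surjective, the newform `f` of `W` at level
`N_E`, `n ∈ 𝒩_k` (square-free product of Kolyvagin primes `ℓ ∤ N_E p`, `ℓ ≡ 1`,
`a_ℓ ≡ ℓ + 1 ≡ 2 (mod p^k)`) and discrete logarithms `ψ_ℓ : (ℤ/ℓ)ˣ → ℤ/p^k`, if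
`ν(n) + ord_{s=1} L(E,s)` is odd then the Kurihara number
`δ_n = kuriharaNumber f (p^k) n ψ = Σ_{a ∈ (ℤ/n)ˣ} \overline{[a/n]⁺_f} Π_{ℓ∣n} ψ_ℓ(a)` vanishes
(C.-H. Kim, arXiv:2203.12159, Prop. 3.16: "If `(−1)^{ν(n)} ≠ w(E)` then `δ̃_n = 0`";
Mazur–Tate 1987, §1.6).

Proof. `deltaParity_sum_eq_zero_of_sign` (this file) is the algebraic core for an arbitrary
`f ∈ S₂(Γ₀(N))`: with the involution `a ↦ a* = −(Na)⁻¹` of `(ℤ/n)ˣ`, the Fricke symmetry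
`[a/n]⁺ = w [a*/n]⁺` and `log_ℓ(a*) = −(log_ℓ a + log_ℓ N)` (`log_ℓ(−1) = 0` in `ℤ/p^k`, `p`
odd) give `δ_n = w(−1)^{ν(n)} (δ_n + Σ_{S ⊊ primes(n)} c_S D(n,S))`, and the incomplete sums
`D(n,S)` vanish (`deltaParity_incompleteSum_eq_zero`, support file
`…StubDeltaParityNormRelation`, from the norm relation of Mazur–Tate 1987, §1.3 and `a_ℓ ≡ 2`);
so `δ_n = −δ_n`, `2δ_n = 0`, `δ_n = 0`. The stub then discharges the four analytic inputs from
the tree: `p`-integrality of `[a/m]⁺_f` for `E[p]` irreducible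
(`IsNewformOf.norm_ratPlusSymbol_div_le_one`,
`hasIrreducibleModPGaloisRep_of_hasSurjectiveModNGaloisRep`); the Hecke relation
`intCast_mul_ratPlusSymbol` (Manin–Drinfeld rationality `ratCast_ratPlusSymbol_holds`) with
`a_ℓ(f) = a_ℓ(E)` (`LFunction_apply_prime_eq_frobeniusTrace` at the good prime `ℓ ∤ N_E`,
`dvd_conductorNorm_iff_not_hasGoodReductionAtPrime`) and `a_ℓ ≡ 2`
(`Kato.isKolyvaginPrime_iff_zmod`);
the Fricke symmetry of the symbols (`IsFrickeEigen.normalizedPlusSymbol_div_eq_mul`,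
`ratPlusSymbol_eq_mul_of_normalizedPlusSymbol_eq`) with sign `w(E) = −ε(f)`
(`IsNewform0.frickeInvolution_eq_smul_holds`, `rootNumber_eq_neg_frickeEigenvalue`); and
`Even r_an ↔ w(E) = 1` (`even_analyticRank_iff_of_isNewformOf_conductorLevel`). The hypotheses
"good ordinary at `p`", `k ≥ 1` and the surjectivity of the `ψ_ℓ` are not used.

References: C.-H. Kim, *The structure of Selmer groups and the Iwasawa main conjecture for
elliptic curves*, arXiv:2203.12159, Prop. 3.16, §3.5; B. Mazur, J. Tate, *Refined conjectures
of the BSD type*, Duke Math. J. 54 (1987), §1.3, §1.6; M. Kurihara, Iwasawa 2012 volume, §1.1.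
-/

noncomputable section

set_option linter.dupNamespace false

open scoped MatrixGroups ModularForm Classical

open CongruenceSubgroup Literature.NumberTheory.EllipticCurves
  Literature.NumberTheory.EllipticCurves.ModularForms

open Literature.NumberTheory.DiophantineGeometry.Dioph (ratModP)

namespace Summit.BirchSwinnertonDyer.BirchSwinnertonDyer.Theorems

/-! ### The functional equation and the parity vanishing (pure algebra) -/

section Parity

variable {p : ℕ} [Fact p.Prime] (k : ℕ) {N : ℕ} [NeZero N] (f : CuspForm (Gamma0 N) 2)

/-- **Mazur–Tate functional equation ⇒ parity vanishing of the Kurihara sum (algebraic core).**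
Let `f ∈ S₂(Γ₀(N))`, `p` odd, `n ≥ 1` square-free with `gcd(N, n) = 1`, and suppose:
the symbols `[z/m]⁺_f`, `m ∣ n`, are `p`-integral; the Hecke relation holds at every prime
`ℓ ∣ n` with `a_ℓ ≡ 2 (mod p^k)`; the Fricke symmetry `[u/n]⁺ = w [v/n]⁺` holds whenever
`A n − u N v = 1` (`w = ±1` the sign); and `w · (−1)^{ν(n)} = −1` in `ℤ/p^k`. Then for every
logarithm-like family `Λ` (additive on reductions of units),
`Σ_{a ∈ (ℤ/n)ˣ} \overline{[a/n]⁺} Π_{ℓ ∣ n} Λ_ℓ(a) = 0`. Proof (Mazur–Tate 1987, §1.6; Kim 2022,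
Prop. 3.16): with the involution `a ↦ a* = −(Na)⁻¹` of `(ℤ/n)ˣ`, `[a/n]⁺ = w[a*/n]⁺`, and
`Λ_ℓ(a*) = −(Λ_ℓ(a) + Λ_ℓ(N))` (`Λ_ℓ(−1) = 0` as `2 ∈ (ℤ/p^k)ˣ`); expanding
`Π_ℓ (Λ_ℓ(a) + Λ_ℓ(N))` over subsets, all proper incomplete sums vanish
(`deltaParity_incompleteSum_eq_zero`), whence `δ = w(−1)^ν δ = −δ`, so `2δ = 0`, `δ = 0`.
[cite: Kim2022StructureSelmer, Prop. 3.16] -/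
theorem deltaParity_sum_eq_zero_of_sign (hp2 : p ≠ 2) {n : ℕ} [NeZero n] (hsq : Squarefree n)
    (hNn : N.Coprime n)
    (hint : ∀ m, m ∣ n → ∀ z : ℤ, ‖((ratPlusSymbol f ((z : ℚ) / m) : ℚ) : ℚ_[p])‖ ≤ 1)
    (hhecke : ∀ ℓ ∈ n.primeFactors, ∃ aℓ : ℤ, (aℓ : ZMod (p ^ k)) = 2 ∧
      ∀ r : ℚ, (aℓ : ℚ) * ratPlusSymbol f r =
        ∑ j : Fin ℓ, ratPlusSymbol f ((r + ((j : ℕ) : ℚ)) / ℓ) + ratPlusSymbol f (ℓ * r))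
    {w : ℤ} (hfr : ∀ A u v : ℤ, A * n - u * (N * v) = 1 →
      ratPlusSymbol f ((u : ℚ) / n) = w * ratPlusSymbol f ((v : ℚ) / n))
    (hsign : (w : ZMod (p ^ k)) * (-1) ^ n.primeFactors.card = -1)
    (Λ : (ℓ : ℕ) → ZMod ℓ → ZMod (p ^ k))
    (hΛ : ∀ {ℓ m : ℕ}, ℓ ∣ m → ∀ u v : (ZMod m)ˣ,
      Λ ℓ ((↑(u * v) : ZMod m).cast) = Λ ℓ ((u : ZMod m).cast) + Λ ℓ ((v : ZMod m).cast)) :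
    ∑ a : (ZMod n)ˣ, ratModP (p ^ k) (ratPlusSymbol f ((((a : ZMod n).val : ℕ) : ℚ) / n)) *
      ∏ ℓ ∈ n.primeFactors, Λ ℓ ((a : ZMod n).cast) = 0 := by
  have hn0 : n ≠ 0 := NeZero.ne n
  have h2 : IsUnit (2 : ZMod (p ^ k)) := by
    rw [show (2 : ZMod (p ^ k)) = ((2 : ℕ) : ZMod (p ^ k)) by norm_cast, ZMod.isUnit_iff_coprime]
    exact (Nat.coprime_two_left.mpr ((Fact.out : p.Prime).odd_of_ne_two hp2)).pow_right k
  -- notation: the symbol, the weight, the incomplete sums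
  obtain ⟨s, hs⟩ : ∃ s : (ZMod n)ˣ → ZMod (p ^ k), ∀ a, s a =
      ratModP (p ^ k) (ratPlusSymbol f ((((a : ZMod n).val : ℕ) : ℚ) / n)) := ⟨_, fun _ ↦ rfl⟩
  obtain ⟨D, hD⟩ : ∃ D : Finset ℕ → ZMod (p ^ k), ∀ T, D T =
      ∑ a : (ZMod n)ˣ, s a * ∏ ℓ ∈ T, Λ ℓ ((a : ZMod n).cast) := ⟨_, fun _ ↦ rfl⟩
  -- `N` as a unit mod `n`, the involution `a ↦ a* = ε a⁻¹`, `ε = -N⁻¹`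
  obtain ⟨Nu, hNu⟩ : ∃ Nu : (ZMod n)ˣ, Nu = ZMod.unitOfCoprime N hNn := ⟨_, rfl⟩
  obtain ⟨ε, hε⟩ : ∃ ε : (ZMod n)ˣ, ε = -Nu⁻¹ := ⟨_, rfl⟩
  obtain ⟨star, hstar⟩ : ∃ star : (ZMod n)ˣ → (ZMod n)ˣ, ∀ a, star a = ε * a⁻¹ :=
    ⟨_, fun _ ↦ rfl⟩
  have hinv : Function.Involutive star := fun a ↦ by
    rw [hstar, hstar, mul_inv_rev, inv_inv, mul_comm a, ← mul_assoc, mul_inv_cancel, one_mul]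
  have hprod : ∀ a, Nu * a * star a = -1 := fun a ↦ by
    rw [hstar, hε, neg_mul, mul_neg, ← mul_inv, mul_inv_cancel]
  -- (1) Fricke: `\overline{[a/n]} = w \overline{[a*/n]}`
  have hint_n : ∀ a : (ZMod n)ˣ,
      ‖((ratPlusSymbol f ((((a : ZMod n).val : ℕ) : ℚ) / n) : ℚ) : ℚ_[p])‖ ≤ 1 := fun a ↦ by
    have h := hint n dvd_rfl ((a : ZMod n).val : ℤ)
    rwa [Int.cast_natCast] at h
  have hfrR : ∀ a : (ZMod n)ˣ, s a = w * s (star a) := by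
    intro a
    have hdvd : (n : ℤ) ∣ (N : ℤ) * (((a : ZMod n).val : ℕ) : ℤ) *
        (((star a : ZMod n).val : ℕ) : ℤ) + 1 := by
      rw [← ZMod.intCast_zmod_eq_zero_iff_dvd]
      push_cast
      rw [ZMod.natCast_zmod_val, ZMod.natCast_zmod_val, ← ZMod.coe_unitOfCoprime N hNn, ← hNu,
        ← Units.val_mul, ← Units.val_mul, hprod a, Units.val_neg, Units.val_one, neg_add_cancel]
    obtain ⟨A, hA⟩ := hdvd
    have h1 : A * (n : ℤ) - (((a : ZMod n).val : ℕ) : ℤ) *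
        ((N : ℤ) * (((star a : ZMod n).val : ℕ) : ℤ)) = 1 := by
      linear_combination -hA
    have h := hfr A _ _ h1
    push_cast at h
    rw [hs, hs, h, deltaParity_ratModP_intCast_mul k w (hint_n _)]
  -- (2) the weight of `a*`
  have hwt : ∀ a : (ZMod n)ˣ, ∏ ℓ ∈ n.primeFactors, Λ ℓ ((↑(star a) : ZMod n).cast) =
      (-1) ^ n.primeFactors.card *
        ∏ ℓ ∈ n.primeFactors, (Λ ℓ ((a : ZMod n).cast) + Λ ℓ ((Nu : ZMod n).cast)) := by
    intro a
    rw [← Finset.prod_neg]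
    refine Finset.prod_congr rfl fun ℓ hℓ ↦ ?_
    have hℓn : ℓ ∣ n := Nat.dvd_of_mem_primeFactors hℓ
    rw [hstar, hΛ hℓn, deltaParity_Λ_inv Λ hΛ hℓn, hε, neg_eq_neg_one_mul, hΛ hℓn,
      deltaParity_Λ_neg_one Λ hΛ h2 hℓn, deltaParity_Λ_inv Λ hΛ hℓn]
    ring
  -- (3) proper incomplete sums vanish
  have hDT : ∀ T ∈ n.primeFactors.powerset, T ≠ n.primeFactors → D T = 0 := fun T hT hTP ↦ by
    rw [hD]
    simp only [hs]
    exact deltaParity_incompleteSum_eq_zero k f Λ hΛ hn0 hsq hint hhecke n dvd_rfl T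
      ((Finset.ssubset_iff_subset_ne).mpr ⟨Finset.mem_powerset.mp hT, hTP⟩)
  -- (4) the functional equation of the full sum
  have hkey : D n.primeFactors = (w : ZMod (p ^ k)) * (-1) ^ n.primeFactors.card *
      D n.primeFactors := by
    calc D n.primeFactors
        = ∑ a : (ZMod n)ˣ, (w * s (star a)) *
            ∏ ℓ ∈ n.primeFactors, Λ ℓ ((a : ZMod n).cast) := by
          rw [hD]
          exact Finset.sum_congr rfl fun a _ ↦ by rw [hfrR a]
      _ = ∑ a : (ZMod n)ˣ, (w * s a) *
            ∏ ℓ ∈ n.primeFactors, Λ ℓ ((↑(star a) : ZMod n).cast) := by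
          refine Fintype.sum_bijective star hinv.bijective _ _ fun a ↦ ?_
          rw [hinv a]
      _ = (w : ZMod (p ^ k)) * (-1) ^ n.primeFactors.card * ∑ a : (ZMod n)ˣ, s a *
            ∏ ℓ ∈ n.primeFactors, (Λ ℓ ((a : ZMod n).cast) + Λ ℓ ((Nu : ZMod n).cast)) := by
          rw [Finset.mul_sum]
          exact Finset.sum_congr rfl fun a _ ↦ by rw [hwt a]; ring
      _ = (w : ZMod (p ^ k)) * (-1) ^ n.primeFactors.card *
            ∑ T ∈ n.primeFactors.powerset,
              (∏ ℓ ∈ n.primeFactors \ T, Λ ℓ ((Nu : ZMod n).cast)) * D T := by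
          rw [deltaParity_sum_mul_prod_add Λ s n.primeFactors]
          simp only [hD]
      _ = (w : ZMod (p ^ k)) * (-1) ^ n.primeFactors.card * D n.primeFactors := by
          rw [Finset.sum_eq_single_of_mem n.primeFactors (Finset.mem_powerset_self _)
            (fun T hT hTP ↦ by rw [hDT T hT hTP, mul_zero]), Finset.sdiff_self,
            Finset.prod_empty, one_mul]
  -- (5) conclude: `D = -D`, `2 D = 0`, `D = 0`
  rw [hsign, neg_one_mul] at hkey
  have h2D : (2 : ZMod (p ^ k)) * D n.primeFactors = 0 := by
    rw [two_mul]
    nth_rewrite 1 [hkey]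
    exact neg_add_cancel _
  have hD0 := (h2D ▸ h2.mul_right_eq_zero).mp rfl
  rw [hD] at hD0
  simpa only [hs] using hD0

end Parity

/-! ### The registered stub -/

/-- **Stub V1 (`stub_delta_parity`) of line `kurihara_order` for crux `SelmerRankLB`: the
Mazur–Tate functional equation kills the Kurihara numbers of the wrong parity.** For `W/ℚ`
globally minimal, `p ≥ 5` (good ordinary, unused) with `ρ̄_{E,p}` surjective, the newform `f`
of `W` at level `N_E`, `n ∈ 𝒩_k` and any discrete logarithms `ψ`: if `ν(n) + ord_{s=1}L(E,s)`
is odd then `kuriharaNumber f (p^k) n ψ = 0`. Assembly of `deltaParity_sum_eq_zero_of_sign` with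
the tree's theorems: `p`-integrality of `[a/m]⁺_f` for `E[p]` irreducible
(`IsNewformOf.norm_ratPlusSymbol_div_le_one`,
`hasIrreducibleModPGaloisRep_of_hasSurjectiveModNGaloisRep`);
the Hecke relation `intCast_mul_ratPlusSymbol` with `a_ℓ(f) = a_ℓ(E)`
(`LFunction_apply_prime_eq_frobeniusTrace`, good reduction at `ℓ ∤ N_E`) and `a_ℓ ≡ 2`
(`Kato.isKolyvaginPrime_iff_zmod`); the Fricke symmetry of the symbols with sign
`w(E) = −ε(f)` (`IsNewform0.frickeInvolution_eq_smul_holds`, `rootNumber_eq_neg_frickeEigenvalue`,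
`IsFrickeEigen.normalizedPlusSymbol_div_eq_mul`); and `Even r_an ↔ w(E) = 1`
(`even_analyticRank_iff_of_isNewformOf_conductorLevel`). In print: Kim 2022, Prop. 3.16;
Mazur–Tate 1987, §1.6. The surjectivity of `ψ`, `k ≥ 1` and ordinarity are not used.
[cite: Kim2022StructureSelmer, Prop. 3.16] -/
theorem stub_delta_parity :
    ∀ (W : WeierstrassCurve ℚ) [W.IsElliptic] [W.IsGloballyMinimal] (p : ℕ) [Fact p.Prime],
      5 ≤ p → W.HasGoodReductionAtPrime p → ¬ (p : ℤ) ∣ W.frobeniusTrace p →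
      W.HasSurjectiveModNGaloisRep p →
      ∀ (_ : NeZero (W.conductorNorm ℤ)) (f : CuspForm (Gamma0 (W.conductorNorm ℤ)) 2),
        IsNewformOf W f →
        ∀ (k n : ℕ) [NeZero n], 1 ≤ k → Kato.IsKolyvaginProduct W p k n →
          ¬ Even (n.primeFactors.card + W.analyticRank) →
          ∀ ψ : (ℓ : ℕ) → (ZMod ℓ)ˣ →* Multiplicative (ZMod (p ^ k)),
            (∀ ℓ ∈ n.primeFactors, Function.Surjective (ψ ℓ)) →
            kuriharaNumber f (p ^ k) n ψ = 0 := by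
  intro W _ _ p _ h5 _hgood _hord hsurj hN f hf k n _ _hk hn hpar ψ _hψ
  haveI := hN
  have hp : p.Prime := Fact.out
  have hp2 : p ≠ 2 := by omega
  haveI : NeZero (p : ℚ) := ⟨Nat.cast_ne_zero.mpr hp.ne_zero⟩
  have hirr : W.HasIrreducibleModPGaloisRep p :=
    hasIrreducibleModPGaloisRep_of_hasSurjectiveModNGaloisRep W p hsurj
  -- (a) integrality of the symbols at levels dividing `n`
  have hint : ∀ m, m ∣ n → ∀ z : ℤ,
      ‖((ratPlusSymbol f ((z : ℚ) / m) : ℚ) : ℚ_[p])‖ ≤ 1 := fun m hm z ↦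
    hf.norm_ratPlusSymbol_div_le_one hp2 hirr
      (Nat.coprime_mul_iff_right.mp (hn.of_dvd hm).coprime).1 z
  -- (b) the Hecke relation at the Kolyvagin primes, `a_ℓ ≡ 2`
  have hhecke : ∀ ℓ ∈ n.primeFactors, ∃ aℓ : ℤ, (aℓ : ZMod (p ^ k)) = 2 ∧
      ∀ r : ℚ, (aℓ : ℚ) * ratPlusSymbol f r =
        ∑ j : Fin ℓ, ratPlusSymbol f ((r + ((j : ℕ) : ℚ)) / ℓ) + ratPlusSymbol f (ℓ * r) := by
    intro ℓ hℓ
    have hK : Kato.IsKolyvaginPrime W p k ℓ := hn.2 ℓ hℓ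
    haveI : Fact ℓ.Prime := ⟨hK.prime⟩
    have hgoodℓ : W.HasGoodReductionAtPrime ℓ := by
      by_contra hbad
      exact hK.not_dvd_conductorNorm
        ((W.dvd_conductorNorm_iff_not_hasGoodReductionAtPrime ℓ).mpr hbad)
    refine ⟨W.frobeniusTrace ℓ, (Kato.isKolyvaginPrime_iff_zmod.mp hK).2.2.2, fun r ↦ ?_⟩
    have hap : cuspCoeff f ℓ = ((W.frobeniusTrace ℓ : ℤ) : ℂ) := by
      rw [hf.2 ℓ, W.LFunction_apply_prime_eq_frobeniusTrace ℓ hgoodℓ]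
    exact intCast_mul_ratPlusSymbol ℓ hf.1 hK.prime hK.not_dvd_conductorNorm hap
      (ratCast_ratPlusSymbol_holds hf.1 hf.coeffField_eq_bot) r
  -- (c) the Fricke symmetry with sign `w(E)`
  have hw2 : W.rootNumber ^ 2 = 1 := by
    rcases W.rootNumber_eq_one_or with h | h <;> rw [h] <;> norm_num
  have hwC : (W.rootNumber : ℂ) = -frickeEigenvalue f :=
    rootNumber_eq_neg_frickeEigenvalue (fun _ _ ↦ IsNewform0.exists_functional_equation_holds)
      (fun _ _ ↦ IsNewform0.frickeEigenvalue_eq_one_or_eq_neg_one_holds) hf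
  have hFE : IsFrickeEigen (W.conductorNorm ℤ) f (-((W.rootNumber : ℤ) : ℂ)) := by
    rw [hwC, neg_neg]
    exact isFrickeEigen_of_frickeInvolution_eq_smul _
      (IsNewform0.frickeInvolution_eq_smul_holds (N := W.conductorNorm ℤ) (k := (2 : ℤ)) hf.1)
  have hfr : ∀ A u v : ℤ, A * n - u * ((W.conductorNorm ℤ : ℕ) * v) = 1 →
      ratPlusSymbol f ((u : ℚ) / n) = W.rootNumber * ratPlusSymbol f ((v : ℚ) / n) :=
    fun A u v h ↦ ratPlusSymbol_eq_mul_of_normalizedPlusSymbol_eq f hw2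
      (hFE.normalizedPlusSymbol_div_eq_mul hw2 (Nat.pos_of_ne_zero (NeZero.ne n)) h)
  -- (d) the sign: `w(E) (-1)^ν(n) = -1`
  have hpar' : Even W.analyticRank ↔ W.rootNumber = 1 :=
    Literature.Barriers.BirchSwinnertonDyer.even_analyticRank_iff_of_isNewformOf_conductorLevel hf
  have hsign : ((W.rootNumber : ℤ) : ZMod (p ^ k)) * (-1) ^ n.primeFactors.card = -1 := by
    rcases W.rootNumber_eq_one_or with h1 | h1
    · have hν : Odd n.primeFactors.card := by
        rcases Nat.even_or_odd n.primeFactors.card with he | ho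
        · exact absurd (he.add (hpar'.mpr h1)) hpar
        · exact ho
      rw [h1, hν.neg_one_pow]
      push_cast
      ring
    · have hr : Odd W.analyticRank := by
        refine Nat.not_even_iff_odd.mp fun he ↦ ?_
        rw [hpar'.mp he] at h1
        norm_num at h1
      have hν : Even n.primeFactors.card := by
        rcases Nat.even_or_odd n.primeFactors.card with he | ho
        · exact he
        · exact absurd (ho.add_odd hr) hpar
      rw [h1, hν.neg_one_pow]
      push_cast
      ring
  -- (e) the discrete logarithms extended by zero, and the Kurihara number as the full sum
  set Λ : (ℓ : ℕ) → ZMod ℓ → ZMod (p ^ k) := fun ℓ x ↦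
    Function.extend Units.val (fun u : (ZMod ℓ)ˣ ↦ Multiplicative.toAdd (ψ ℓ u)) 0 x with hΛdef
  have hΛu : ∀ {ℓ m : ℕ} (h : ℓ ∣ m) (u : (ZMod m)ˣ),
      Λ ℓ ((u : ZMod m).cast) = Multiplicative.toAdd (ψ ℓ (ZMod.unitsMap h u)) := by
    intro ℓ m h u
    rw [← ZMod.unitsMap_val h, hΛdef]
    exact Units.val_injective.extend_apply _ _ _
  have hΛ : ∀ {ℓ m : ℕ}, ℓ ∣ m → ∀ u v : (ZMod m)ˣ,
      Λ ℓ ((↑(u * v) : ZMod m).cast) = Λ ℓ ((u : ZMod m).cast) + Λ ℓ ((v : ZMod m).cast) := by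
    intro ℓ m h u v
    rw [hΛu h, hΛu h, hΛu h, map_mul, map_mul, toAdd_mul]
  have hδ : kuriharaNumber f (p ^ k) n ψ =
      ∑ a : (ZMod n)ˣ, ratModP (p ^ k) (ratPlusSymbol f ((((a : ZMod n).val : ℕ) : ℚ) / n)) *
        ∏ ℓ ∈ n.primeFactors, Λ ℓ ((a : ZMod n).cast) := by
    rw [kuriharaNumber_def]
    refine Finset.sum_congr rfl fun a _ ↦ ?_
    congr 1
    rw [← Finset.prod_attach n.primeFactors (fun ℓ ↦ Λ ℓ ((a : ZMod n).cast))]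
    exact Finset.prod_congr rfl fun ℓ _ ↦ (hΛu (Nat.dvd_of_mem_primeFactors ℓ.2) a).symm
  rw [hδ]
  exact deltaParity_sum_eq_zero_of_sign k f hp2 hn.squarefree
    (Nat.Coprime.coprime_mul_right hn.coprime.symm) hint hhecke hfr hsign Λ hΛ

end Summit.BirchSwinnertonDyer.BirchSwinnertonDyer.Theorems

end
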